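import Literature.AlgebraicGeometry.Hyperkaehler.TotalCohomologyCross
import Literature.AlgebraicGeometry.Hyperkaehler.TotalCohomologyLefschetzModule
import Mathlib.LinearAlgebra.Dual.Lemmas
import Mathlib.LinearAlgebra.FiniteDimensional.Defs
import HarnessLib

/-!
# V0 (`HilbertKummerTransfer`) — algebraic plumbing: contractions `φ ⊗ id`, the submodule `M ⊗ N'`, the parity
# operator on `H*` and the Koszul rule without homogeneity (cell `hodge-kum4`, lane (V), seat p2)

Route `KummerFixedLocus`, item `HilbertKummerTransfer` (stmt-Ventures-20142).  HONEST FRAMING: helper lemmas only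
(linear algebra and bookkeeping on the total cohomology `H*(Y; R) = ⨁ₖ Hᵏ(Y; R)`); nothing about `Kⁿ(A)`, V0, L1 or the
Hodge conjecture is proved in this file.

* §1 `contract φ = (φ ⊗ id) : M ⊗ N → N` for a functional `φ` (`contract_tmul : m ⊗ n ↦ φ m • n`), its naturality
  `contract_lTensor` (`(φ ⊗ id) ∘ (id ⊗ T) = T ∘ (φ ⊗ id)`), `contract_rTensor`.
* §2 **`tensorWith M N'`** = the span of the `m ⊗ n'`, `n' ∈ N'` ("`M ⊗ N'` inside `M ⊗ N`") and the dual-functional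
  criterion **`mem_tensorWith_iff`**: for `M` finite-dimensional, `t ∈ M ⊗ N'` iff `(φ ⊗ id) t ∈ N'` for every `φ ∈ M^*`
  (expand `t = Σᵢ bᵢ ⊗ (bᵢ^* ⊗ id) t` in a basis, `sum_basis_tmul_contract`); corollaries `tensorWith_mono`,
  `lTensor_mem_tensorWith` (stability under `id ⊗ T` when `T N' ⊆ N''`), `rTensor_mem_tensorWith`.
* §3 **the parity operator** `parityOp R Y` (`(-1)ᵏ` on `Hᵏ`): an involutive ring automorphism of `H*` commuting with
  pull-backs (`parityOp_ofDegree`, `parityOp_totalCup`, `parityOp_parityOp`, `totalPullback_parityOp`), and the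
  **Koszul rule for an inhomogeneous middle factor**: `(a × s) ⌣ (a' × s') = (a ⌣ a') × ((P^{|a'|} s) ⌣ s')` for `a'`
  homogeneous (`totalCup_totalCross_tmul_parity`, from `Hyperkaehler.totalCup_totalCross_tmul`).
* §4 operators of degree `-2`: from `⁅h, Λ⁆ = -2Λ` (`IsDualLefschetz`), `Λ` maps `Hᵏ` into `H^{k-2}`
  (`exists_apply_ofDegree_eq_of_isDualLefschetz`) and commutes with the parity operator (`parityOp_comp_eq_of_isDualLefschetz`); a cup-closed, `Λ`-stable span of
  HOMOGENEOUS generators is parity-stable (`parityOp_mem_opCupSpan`).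
-/

noncomputable section

open DirectSum TensorProduct
open Literature.AlgebraicTopology.SingularHomology
open Literature.AlgebraicGeometry.Hyperkaehler

namespace Summit.Ventures.HodgeKum4.HilbertKummer

universe u v

/-! ### §1 Contraction with a functional -/

section Contract

variable {K : Type*} [Field K] {M N N₂ : Type*} [AddCommGroup M] [Module K M] [AddCommGroup N] [Module K N]
  [AddCommGroup N₂] [Module K N₂]

variable (N) in
/-- **`φ ⊗ id : M ⊗ N → N`** for a functional `φ : M → K` (followed by `K ⊗ N ≅ N`). -/
def contract (φ : Module.Dual K M) : M ⊗[K] N →ₗ[K] N :=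
  (TensorProduct.lid K N : K ⊗[K] N →ₗ[K] N) ∘ₗ φ.rTensor N

/-- `(φ ⊗ id)(m ⊗ n) = φ(m) • n`. -/
@[simp]
theorem contract_tmul (φ : Module.Dual K M) (m : M) (n : N) : contract N φ (m ⊗ₜ[K] n) = φ m • n := by
  simp [contract]

/-- Naturality: `(φ ⊗ id) ((id ⊗ T) t) = T ((φ ⊗ id) t)`. -/
theorem contract_lTensor (φ : Module.Dual K M) (T : N →ₗ[K] N₂) (t : M ⊗[K] N) :
    contract N₂ φ (T.lTensor M t) = T (contract N φ t) := by
  induction t using TensorProduct.induction_on with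
  | zero => simp
  | add x y hx hy => simp [map_add, hx, hy]
  | tmul m n => simp [LinearMap.lTensor_tmul, map_smul]

/-- `(φ ⊗ id) ((S ⊗ id) t) = ((φ ∘ S) ⊗ id) t`. -/
theorem contract_rTensor (φ : Module.Dual K M) (S : M →ₗ[K] M) (t : M ⊗[K] N) :
    contract N φ (S.rTensor N t) = contract N (φ ∘ₗ S) t := by
  induction t using TensorProduct.induction_on with
  | zero => simp
  | add x y hx hy => simp [map_add, hx, hy]
  | tmul m n => simp [LinearMap.rTensor_tmul]

/-- **Expansion in a basis: `t = Σᵢ bᵢ ⊗ (bᵢ^* ⊗ id) t`.** -/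
theorem sum_basis_tmul_contract {ι : Type*} [Fintype ι] (b : Module.Basis ι K M) (t : M ⊗[K] N) :
    ∑ i, b i ⊗ₜ[K] contract N (b.coord i) t = t := by
  induction t using TensorProduct.induction_on with
  | zero => simp
  | add x y hx hy =>
    simp only [map_add, tmul_add, Finset.sum_add_distrib, hx, hy]
  | tmul m n =>
    simp only [contract_tmul, Module.Basis.coord_apply, tmul_smul, smul_tmul']
    rw [← TensorProduct.sum_tmul, b.sum_repr m]

/-! ### §2 The submodule `M ⊗ N'` and the dual-functional criterion -/

variable (M) in
/-- **`M ⊗ N'` inside `M ⊗ N`**: the span of the pure tensors `m ⊗ n'`, `n' ∈ N'`. -/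
def tensorWith (N' : Submodule K N) : Submodule K (M ⊗[K] N) :=
  Submodule.span K {t | ∃ (m : M) (n : N), n ∈ N' ∧ t = m ⊗ₜ[K] n}

/-- Generators. -/
theorem tmul_mem_tensorWith {N' : Submodule K N} (m : M) {n : N} (hn : n ∈ N') : m ⊗ₜ[K] n ∈ tensorWith M N' :=
  Submodule.subset_span ⟨m, n, hn, rfl⟩

/-- `M ⊗ N'` is monotone in `N'`. -/
theorem tensorWith_mono {N' N'' : Submodule K N} (h : N' ≤ N'') : tensorWith M N' ≤ tensorWith M N'' :=
  Submodule.span_mono fun _ ⟨m, n, hn, ht⟩ ↦ ⟨m, n, h hn, ht⟩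

/-- `M ⊗ ⊤ = ⊤`. -/
theorem tensorWith_top : tensorWith M (⊤ : Submodule K N) = ⊤ := by
  rw [eq_top_iff]
  rintro t -
  induction t using TensorProduct.induction_on with
  | zero => exact Submodule.zero_mem _
  | add x y hx hy => exact Submodule.add_mem _ hx hy
  | tmul m n => exact tmul_mem_tensorWith m Submodule.mem_top

/-- `(φ ⊗ id)(M ⊗ N') ⊆ N'`. -/
theorem contract_mem_of_mem_tensorWith {N' : Submodule K N} (φ : Module.Dual K M) {t : M ⊗[K] N}
    (ht : t ∈ tensorWith M N') : contract N φ t ∈ N' := by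
  induction ht using Submodule.span_induction with
  | mem t ht =>
    obtain ⟨m, n, hn, rfl⟩ := ht
    rw [contract_tmul]
    exact N'.smul_mem _ hn
  | zero => rw [map_zero]; exact N'.zero_mem
  | add x y _ _ hx hy => rw [map_add]; exact N'.add_mem hx hy
  | smul c x _ hx => rw [map_smul]; exact N'.smul_mem c hx

/-- **The dual-functional criterion**: for `M` finite-dimensional, `t ∈ M ⊗ N'` iff `(φ ⊗ id) t ∈ N'` for every
functional `φ` on `M`. -/
theorem mem_tensorWith_iff [FiniteDimensional K M] {N' : Submodule K N} (t : M ⊗[K] N) :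
    t ∈ tensorWith M N' ↔ ∀ φ : Module.Dual K M, contract N φ t ∈ N' := by
  refine ⟨fun ht φ ↦ contract_mem_of_mem_tensorWith φ ht, fun h ↦ ?_⟩
  rw [← sum_basis_tmul_contract (Module.finBasis K M) t]
  exact Submodule.sum_mem _ fun i _ ↦ tmul_mem_tensorWith _ (h _)

/-- **`id ⊗ T` maps `M ⊗ N'` into `M ⊗ N''` when `T N' ⊆ N''`.** -/
theorem lTensor_mem_tensorWith {N' : Submodule K N} {N'' : Submodule K N₂} (T : N →ₗ[K] N₂)
    (hT : ∀ n ∈ N', T n ∈ N'') {t : M ⊗[K] N} (ht : t ∈ tensorWith M N') : T.lTensor M t ∈ tensorWith M N'' := by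
  induction ht using Submodule.span_induction with
  | mem t ht =>
    obtain ⟨m, n, hn, rfl⟩ := ht
    rw [LinearMap.lTensor_tmul]
    exact tmul_mem_tensorWith m (hT n hn)
  | zero => rw [map_zero]; exact Submodule.zero_mem _
  | add x y _ _ hx hy => rw [map_add]; exact Submodule.add_mem _ hx hy
  | smul c x _ hx => rw [map_smul]; exact Submodule.smul_mem _ c hx

/-- **`S ⊗ id` preserves `M ⊗ N'`.** -/
theorem rTensor_mem_tensorWith {N' : Submodule K N} (S : M →ₗ[K] M) {t : M ⊗[K] N} (ht : t ∈ tensorWith M N') :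
    S.rTensor N t ∈ tensorWith M N' := by
  induction ht using Submodule.span_induction with
  | mem t ht =>
    obtain ⟨m, n, hn, rfl⟩ := ht
    rw [LinearMap.rTensor_tmul]
    exact tmul_mem_tensorWith _ hn
  | zero => rw [map_zero]; exact Submodule.zero_mem _
  | add x y _ _ hx hy => rw [map_add]; exact Submodule.add_mem _ hx hy
  | smul c x _ hx => rw [map_smul]; exact Submodule.smul_mem _ c hx

/-- A general tensor `Σ mᵢ ⊗ nᵢ` with all `nᵢ ∈ N'` lies in `M ⊗ N'`: induction form. -/
theorem tmul_add_mem_tensorWith {N' : Submodule K N} {t t' : M ⊗[K] N} (ht : t ∈ tensorWith M N')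
    (ht' : t' ∈ tensorWith M N') : t + t' ∈ tensorWith M N' :=
  Submodule.add_mem _ ht ht'

end Contract

/-! ### §3 The parity operator on `H*(Y; R)` and the Koszul rule with an inhomogeneous middle factor -/

section Parity

variable {R : Type v} [CommRing R] {P Y Z : Type u} [TopologicalSpace P] [TopologicalSpace Y] [TopologicalSpace Z]

variable (R Y) in
/-- **The parity operator** `P = (-1)ᵏ` on `Hᵏ(Y; R)` (the grading involution of `H* = H^{ev} ⊕ H^{odd}`). -/
def parityOp : Module.End R (totalCohomology R Y) :=
  toModule R ℕ (totalCohomology R Y) fun k ↦ ((-1 : R) ^ k) • ofDegree R Y k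

/-- `P (x ∈ Hᵏ) = (-1)ᵏ x`. -/
@[simp]
theorem parityOp_ofDegree (k : ℕ) (x : singularCohomology R R Y k) :
    parityOp R Y (ofDegree R Y k x) = ((-1 : R) ^ k) • ofDegree R Y k x := by
  simp only [parityOp, toModule_lof, LinearMap.smul_apply]

/-- `Pⁱ (x ∈ Hᵏ) = (-1)^{ik} x`. -/
theorem parityOp_pow_ofDegree (i k : ℕ) (x : singularCohomology R R Y k) :
    (parityOp R Y ^ i) (ofDegree R Y k x) = ((-1 : R) ^ (i * k)) • ofDegree R Y k x := by
  induction i with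
  | zero => simp
  | succ i ih =>
    rw [pow_succ', Module.End.mul_apply, ih, map_smul, parityOp_ofDegree, smul_smul, ← pow_add]
    congr 2
    ring

/-- `P` is an involution. -/
theorem parityOp_parityOp (v : totalCohomology R Y) : parityOp R Y (parityOp R Y v) = v := by
  induction v using DirectSum.induction_on with
  | zero => simp only [map_zero]
  | add x y hx hy => simp only [map_add, hx, hy]
  | of k x =>
    rw [← lof_eq_of R]
    change parityOp R Y (parityOp R Y (ofDegree R Y k x)) = ofDegree R Y k x
    rw [parityOp_ofDegree, map_smul, parityOp_ofDegree, smul_smul, ← pow_add, ← two_mul, pow_mul, neg_one_sq,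
      one_pow, one_smul]

/-- **`P` is multiplicative**: `P(x ⌣ y) = P x ⌣ P y` (degrees add). -/
theorem parityOp_totalCup (x y : totalCohomology R Y) :
    parityOp R Y (totalCup R Y x y) = totalCup R Y (parityOp R Y x) (parityOp R Y y) := by
  induction x using DirectSum.induction_on with
  | zero => simp only [map_zero, LinearMap.zero_apply]
  | add x x' hx hx' => simp only [map_add, LinearMap.add_apply, hx, hx']
  | of p a =>
  induction y using DirectSum.induction_on with
  | zero => simp only [map_zero]
  | add y y' hy hy' => simp only [map_add, hy, hy']
  | of q b =>
    simp only [← lof_eq_of R]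
    change parityOp R Y (totalCup R Y (ofDegree R Y p a) (ofDegree R Y q b)) =
      totalCup R Y (parityOp R Y (ofDegree R Y p a)) (parityOp R Y (ofDegree R Y q b))
    rw [totalCup_lof, parityOp_ofDegree, parityOp_ofDegree, parityOp_ofDegree, LinearMap.map_smul₂, map_smul,
      totalCup_lof, smul_smul, ← pow_add]

/-- `P` commutes with pull-backs (they preserve degrees). -/
theorem totalPullback_parityOp {Y' : Type u} [TopologicalSpace Y'] (f : C(Y, Y')) (v : totalCohomology R Y') :
    totalPullback R f (parityOp R Y' v) = parityOp R Y (totalPullback R f v) := by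
  induction v using DirectSum.induction_on with
  | zero => simp only [map_zero]
  | add x y hx hy => simp only [map_add, hx, hy]
  | of k x =>
    rw [← lof_eq_of R]
    change totalPullback R f (parityOp R Y' (ofDegree R Y' k x)) = parityOp R Y (totalPullback R f (ofDegree R Y' k x))
    rw [parityOp_ofDegree, map_smul, totalPullback_lof, parityOp_ofDegree]

/-- **Koszul rule with an inhomogeneous middle factor**: for `a'` homogeneous of degree `i` and ARBITRARY `a, s, s'`,
`(a × s) ⌣ (a' × s') = (a ⌣ a') × ((Pⁱ s) ⌣ s')` (the sign `(-1)^{i|s|}` of `Hyperkaehler.totalCup_totalCross_tmul`,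
absorbed into the parity operator). -/
theorem totalCup_totalCross_tmul_parity (p : C(P, Y)) (q : C(P, Z)) (a : totalCohomology R Y)
    (s : totalCohomology R Z) (i : ℕ) (a' : singularCohomology R R Y i) (s' : totalCohomology R Z) :
    totalCup R P (totalCross R p q (a ⊗ₜ[R] s)) (totalCross R p q (ofDegree R Y i a' ⊗ₜ[R] s')) =
      totalCross R p q (totalCup R Y a (ofDegree R Y i a') ⊗ₜ[R] totalCup R Z ((parityOp R Z ^ i) s) s') := by
  induction s using DirectSum.induction_on with
  | zero => simp only [tmul_zero, map_zero, LinearMap.zero_apply]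
  | add y y' hy hy' => simp only [tmul_add, map_add, LinearMap.add_apply, hy, hy']
  | of j b =>
    rw [← lof_eq_of R]
    change totalCup R P (totalCross R p q (a ⊗ₜ[R] ofDegree R Z j b)) _ =
      totalCross R p q (_ ⊗ₜ[R] totalCup R Z ((parityOp R Z ^ i) (ofDegree R Z j b)) s')
    rw [totalCup_totalCross_tmul, parityOp_pow_ofDegree, LinearMap.map_smul₂, tmul_smul, map_smul]

end Parity

/-! ### §4 Operators of degree `-2` and parity-stability of `⟨Λ, ∪⟩`-spans -/

section DegreeMinusTwo

variable {R : Type v} [CommRing R] {Y : Type u} [TopologicalSpace Y]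

/-- **A dual Lefschetz operator lowers the degree by `2`**: for `x ∈ Hᵏ`, `Λ x ∈ H^{k-2}` (`Λ` is the abstract
partner `ᶜΛ` of `(L_a, h)`, `IsDualLefschetz.eq_dual_self`, which has degree `-2`; for `k < 2` the target degree part
is `0`, and with truncated subtraction the statement stays uniform). -/
theorem exists_apply_ofDegree_eq_of_isDualLefschetz {K : Type v} [Field K] [CharZero K] {Y : Type u}
    [TopologicalSpace Y] [Module.Finite K (totalCohomology K Y)] {N : ℕ} {a : singularCohomology K K Y 2}
    {Λ : Module.End K (totalCohomology K Y)} (hΛ : IsDualLefschetz N a Λ) (k : ℕ) (x : singularCohomology K K Y k) :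
    ∃ y : singularCohomology K K Y (k - 2), Λ (ofDegree K Y k x) = ofDegree K Y (k - 2) y := by
  have hx : ofDegree K Y k x ∈ Literature.Algebra.Lie.degreeSpace (degreeOperator K Y N) ((k : ℤ) - N) :=
    ofDegree_mem_degreeSpace N k rfl x
  have hΛx : Λ (ofDegree K Y k x) ∈ Literature.Algebra.Lie.degreeSpace (degreeOperator K Y N) ((k : ℤ) - N - 2) := by
    rw [hΛ.eq_dual_self]
    exact Literature.Algebra.Lie.HasLefschetzProperty.dual_apply_mem _ _ hx
  by_cases hk : 2 ≤ k
  · rw [degreeSpace_degreeOperator_eq_range N (k - 2) (by push_cast [Nat.cast_sub hk]; ring)] at hΛx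
    obtain ⟨y, hy⟩ := hΛx
    exact ⟨y, hy.symm⟩
  · rw [degreeSpace_degreeOperator_eq_bot N (by omega)] at hΛx
    rw [(Submodule.mem_bot K).1 hΛx]
    exact ⟨0, by rw [map_zero]⟩

/-- For `k < 2` a dual Lefschetz operator kills `Hᵏ`. -/
theorem apply_ofDegree_eq_zero_of_isDualLefschetz {K : Type v} [Field K] [CharZero K] {Y : Type u}
    [TopologicalSpace Y] [Module.Finite K (totalCohomology K Y)] {N : ℕ} {a : singularCohomology K K Y 2}
    {Λ : Module.End K (totalCohomology K Y)} (hΛ : IsDualLefschetz N a Λ) {k : ℕ} (hk : k < 2)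
    (x : singularCohomology K K Y k) : Λ (ofDegree K Y k x) = 0 := by
  have hx : ofDegree K Y k x ∈ Literature.Algebra.Lie.degreeSpace (degreeOperator K Y N) ((k : ℤ) - N) :=
    ofDegree_mem_degreeSpace N k rfl x
  have hΛx : Λ (ofDegree K Y k x) ∈ Literature.Algebra.Lie.degreeSpace (degreeOperator K Y N) ((k : ℤ) - N - 2) := by
    rw [hΛ.eq_dual_self]
    exact Literature.Algebra.Lie.HasLefschetzProperty.dual_apply_mem _ _ hx
  rw [degreeSpace_degreeOperator_eq_bot N (by omega)] at hΛx
  exact (Submodule.mem_bot K).1 hΛx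

/-- Hence **a dual Lefschetz operator commutes with the parity operator** (it is homogeneous of even degree). -/
theorem parityOp_comp_eq_of_isDualLefschetz {K : Type v} [Field K] [CharZero K] {Y : Type u} [TopologicalSpace Y]
    [Module.Finite K (totalCohomology K Y)] {N : ℕ} {a : singularCohomology K K Y 2}
    {Λ : Module.End K (totalCohomology K Y)} (hΛ : IsDualLefschetz N a Λ) :
    parityOp K Y ∘ₗ Λ = Λ ∘ₗ parityOp K Y := by
  refine DirectSum.linearMap_ext K fun k ↦ LinearMap.ext fun x ↦ ?_
  simp only [LinearMap.coe_comp, Function.comp_apply]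
  change parityOp K Y (Λ (ofDegree K Y k x)) = Λ (parityOp K Y (ofDegree K Y k x))
  by_cases hk : 2 ≤ k
  · obtain ⟨y, hy⟩ := exists_apply_ofDegree_eq_of_isDualLefschetz hΛ k x
    rw [hy, parityOp_ofDegree, parityOp_ofDegree, map_smul, hy]
    congr 1
    conv_rhs => rw [show k = (k - 2) + 2 from (Nat.sub_add_cancel hk).symm]
    rw [pow_add, neg_one_sq, mul_one]
  · rw [parityOp_ofDegree, map_smul, apply_ofDegree_eq_zero_of_isDualLefschetz hΛ (by omega), map_zero, smul_zero]

/-- **A `⟨Λ, ∪⟩`-span of homogeneous generators is parity-stable** when `Λ` commutes with the parity operator. -/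
theorem parityOp_mem_opCupSpan {Λ : Module.End R (totalCohomology R Y)} (hΛ : parityOp R Y ∘ₗ Λ = Λ ∘ₗ parityOp R Y)
    {G : Set (totalCohomology R Y)} (hG : ∀ g ∈ G, ∃ (k : ℕ) (x : singularCohomology R R Y k), g = ofDegree R Y k x)
    {s : totalCohomology R Y} (hs : s ∈ opCupSpan R Y Λ G) : parityOp R Y s ∈ opCupSpan R Y Λ G := by
  -- the set of `s` with `P s` in the span is a cup-closed `Λ`-stable submodule containing `G`
  let T : Submodule R (totalCohomology R Y) := (opCupSpan R Y Λ G).comap (parityOp R Y)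
  have hT : opCupSpan R Y Λ G ≤ T := by
    refine opCupSpan_le (fun g hg ↦ ?_) (fun x hx y hy ↦ ?_) (fun x hx ↦ ?_)
    · obtain ⟨k, x, rfl⟩ := hG g hg
      change parityOp R Y (ofDegree R Y k x) ∈ opCupSpan R Y Λ G
      rw [parityOp_ofDegree]
      exact Submodule.smul_mem _ _ (subset_opCupSpan hg)
    · change parityOp R Y (totalCup R Y x y) ∈ opCupSpan R Y Λ G
      rw [parityOp_totalCup]
      exact isCupClosed_opCupSpan _ hx _ hy
    · change parityOp R Y (Λ x) ∈ opCupSpan R Y Λ G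
      rw [← LinearMap.comp_apply, hΛ, LinearMap.comp_apply]
      exact mem_stabilizerLie_opCupSpan _ hx
  exact hT hs

/-- The powers of the parity operator also preserve such spans. -/
theorem parityOp_pow_mem_opCupSpan {Λ : Module.End R (totalCohomology R Y)}
    (hΛ : parityOp R Y ∘ₗ Λ = Λ ∘ₗ parityOp R Y) {G : Set (totalCohomology R Y)}
    (hG : ∀ g ∈ G, ∃ (k : ℕ) (x : singularCohomology R R Y k), g = ofDegree R Y k x) (i : ℕ)
    {s : totalCohomology R Y} (hs : s ∈ opCupSpan R Y Λ G) : (parityOp R Y ^ i) s ∈ opCupSpan R Y Λ G := by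
  induction i with
  | zero => simpa using hs
  | succ i ih => rw [pow_succ', Module.End.mul_apply]; exact parityOp_mem_opCupSpan hΛ hG ih

/-- The homogeneous classes of prescribed degrees are homogeneous (for `parityOp_mem_opCupSpan`). -/
theorem degreeClasses_homogeneous (D : Set ℕ) :
    ∀ g ∈ degreeClasses R Y D, ∃ (k : ℕ) (x : singularCohomology R R Y k), g = ofDegree R Y k x := by
  intro g hg
  simp only [degreeClasses, Set.mem_iUnion, Set.mem_range] at hg
  obtain ⟨k, -, x, rfl⟩ := hg
  exact ⟨k, x, rfl⟩

/-- Images of homogeneous classes under a pull-back are homogeneous (for `parityOp_mem_opCupSpan`). -/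
theorem image_degreeClasses_homogeneous {Y' : Type u} [TopologicalSpace Y'] (f : C(Y, Y')) (D : Set ℕ) :
    ∀ g ∈ totalPullback R f '' degreeClasses R Y' D, ∃ (k : ℕ) (x : singularCohomology R R Y k), g = ofDegree R Y k x := by
  rintro _ ⟨v, hv, rfl⟩
  obtain ⟨k, x, rfl⟩ := degreeClasses_homogeneous D v hv
  exact ⟨k, _, totalPullback_lof f k x⟩

end DegreeMinusTwo

end Summit.Ventures.HodgeKum4.HilbertKummer

end
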